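import Summits.QuantumFields.YangMills.Theorems.UnitScaleTiltProp7FibreELOfTangentCriticalSU2
import Summits.QuantumFields.YangMills.Theorems.UnitScaleTiltProp7TangentCriticalSplit
import Summits.QuantumFields.YangMills.Theorems.UnitScaleTiltProp7ChartVelocityDexp
import Summits.QuantumFields.YangMills.Theorems.UnitScaleTiltProp7ChartRealityKnitS
import Summits.QuantumFields.YangMills.Theorems.UnitScaleTiltProp7B8Prop7Div
import Summits.QuantumFields.YangMills.Theorems.UnitScaleTiltProp7PV3CDELogChart
import Summits.QuantumFields.YangMills.Theorems.UnitScaleTiltProp7SPrintDefsS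
import Literature.MathematicalPhysics.QuantumFieldTheory.Balaban1983to89.B11Ineq190FromProp3
import HarnessLib

/-!
# Route `UnitScaleTilt`, crux K1 child «MinimiserStabilityRegPr» (stmt-QuantumFields-19200), skeleton v10, stub `stub_existenceMinimalOrbit` (EX), route (α) — **THE E–L CONJUNCT
# (iii) OF THE KNIT'S XL ROW `hXtw‴` PROVED FROM PRINT'S (93) IN `U₀`'S CHART AND THE INFINITESIMAL SLICE THEOREM AT THE CHART POINT** (knit lineage, 2026-08-28; the
# assembly of the `hXtw‴`(iii) transport: T1 ✓`Prop7ChartVelocityDexp` + (D47) + (51) + ✓`Prop7TangentCriticalSplit` + ✓`Prop7FibreELOfTangentCriticalSU2`).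

Cell `ym3-torus`, width seat `ym-ust-19200-w2` (gen 5; EX knit lineage).  THEOREMS ONLY (0 `def`, 0 `sorry`).  `--supports stmt-QuantumFields-19200 --as helper`, count-neutral.
YM₃ on T³ is a ladder rung (R3), not the Clay problem; nothing here claims the stub, the crux, d = 4 or the mass gap.

THE POINT.  The EX knit of record v3.2ˢ (✓`Prop7StubEXOfChartPiecesTwS5`) displays one XL row `hXtw‴` = ∃ X: (i) chart identity, (ii) (19)-size, (iii) «every gauge copy `W = U′^u` of the
chart point `U′ = e^{iX}U₀` is E–L-critical along every bondwise-differentiable fibre curve through `W`».  Its letters `𝔊(U₀)`, `(δ∕δA′)V`, `H₁(U₀)` are OPAQUE, so (iii) cannot follow from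
the row's own prefix (nothing displayed ties the equation (111) to the Wilson action): ONE row connecting (111) to `𝒜` must stay displayed — print's (93), «the chart functional
`A″ ↦ 𝒜(e^{χ(A″)}U₀)` is critical at the solution `A′` along the linear slice (82)–(83) `QδA′ = 0`, `R_S D*δA′ = 0`» ([Balaban1985Variational] Sect. C, derived there from (101)–(111)).
THIS FILE proves (iii) at one member from that row (`hCrit`, ray form) and the infinitesimal slice theorem at the chart point (`hSplit`: every `𝔰𝔲(2)`-valued `ξ ∈ ker QSym(U′)` is the
`U′`-velocity `g(ad(−χ(A′)))(Dχ(A′)δ)` of a slice ray plus an infinitesimal gauge direction at `U′` — [Balaban1985RegularSpaces] Sect. D ∕ [Balaban1985Averaging] Prop. 4 linearised;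
suppliers of record: the T2∕T3∕FR₀ lineage of seat `ym-ust-20520-w5` and ✓`Prop7GaugeSliceDecompositionSplit`), over ANY slice predicate `Sl` (the knit reads it at
`Sl δ := QTwS U₀ δ = 0 ∧ IsLandauPrintS c₀ cB U₀ δ`).

WHAT IS PROVED (sorry-free, no definition; ns `…Theorems.Prop7FibreELOfCritSplit`; `χ(A″) = A″ − H·Dfix(CmapTwS U₀) H C₂ˢ A″`, `C₂ˢ = 40M₀ˢ∕(e·η)²`, `M₀ˢ = 6(2e + 2700Lε₀)`).
§1 ★ `hasDerivAt_clampLine` — the CLAMPED real line `t ↦ A′ + clamp_{t₀}(t)•δ` has derivative `δ` at `0` and never leaves the segment `|s| ≤ t₀` (generic normed `ℂ`-space).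
§2 ★★ `hasFDerivAt_chartTwS_of_lt` — (D47): `χ` is Fréchet-differentiable at every `A″` with `2‖A″‖ < ε` in the window `9C₂ˢbε < 1`, `6ε ≤ eη` (✓`B11Ineq190FromProp3.hasFDerivAt_Dfix_of_lt`
   over ✓`Prop7CmapTwSymInputs.inputs_CmapTwS`; `H` read as a continuous linear map of the finite-dimensional carriers).
§2 ★★ `isHermitian_trace_zero_chartTwS` — (51) along the ray: for real `A″` with `‖A″‖ < ε`, `−i·χ(A″)` is Hermitian-traceless (✓`Prop7ChartRealityKnitS.isHermitian_trace_zero_of_chartS`), so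
   `expHermField(−i·χ(A″))` IS `e^{χ(A″)}` bondwise (no junk branch).
§3 ★★★ `lin_eq_zero_of_crit_ray` — `hCrit` (ray form of (93) at `A′` in the direction `δ`) ⟹ `Lin_{U′}` vanishes on the `U′`-velocity `b ↦ g(ad(−iX(b)))((Dχ(A′)δ)(b))`
   (T1 ✓`hasDerivAt_wilsonAction4_chartCurve` along the CLAMPED ray — `SU(2)`-valued for all `t` by §2 — which agrees with the displayed ray near `t = 0`).
§4 ★★★ `fibreEL_of_crit_split` — conjunct (iii) of `hXtw‴` VERBATIM at the member, from `hCrit` + `hSplit` + the member numerics: `U′ ∈ 𝔘_k(178(ε₀+e))` by [Balaban1985RegularSpaces] Prop. 7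
   (✓`regPr_emb15_of_in19` ∘ ✓`in19_expHermField_of_nMax19_lt`), `hcrit` by ✓`tangentCritical_su2_of_split` with `T := {g(ad(−iX))(Dχ(A′)δ) | δ real, Sl δ}`, then ✓`fibreEL_of_tangentCritical_su2_QSym`.
HONEST SCOPE: calculus and bookkeeping over landed theorems; (93) (`hCrit`) and the slice split (`hSplit`) are HYPOTHESES here with the suppliers named above; nothing of print is asserted;
the knit of record is unchanged by this file (the v3.3ˢ re-knit that displays `hCrit93`∕`hSplit` in place of `hXtw‴`(iii) is the sequel).

References: T. Bałaban, CMP 102 (1985) 277–309 [Balaban1985Variational] ((47)–(51) pp.285–286, (82)–(83) p.290, (93) p.291, (111)–(112) p.294, Prop. 5 p.294, (141) p.299); CMP 99 (1985) 75–102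
[Balaban1985RegularSpaces] (Prop. 7 p.98, Sect. D pp.89–95); CMP 98 (1985) 17–51 [Balaban1985Averaging] ((32)–(34) pp.22–23, Prop. 4 p.31).
-/

set_option autoImplicit false

noncomputable section

open scoped BigOperators Matrix.Norms.L2Operator Matrix Topology
open Filter

namespace Summit.QuantumFields.YangMills.Theorems.Prop7FibreELOfCritSplit

open NormedSpace
open Literature.Analysis.Calculus.ExpDifferential (ad gSer)
open Literature.MathematicalPhysics.QuantumFieldTheory.Balaban1983to89
open Literature.MathematicalPhysics.QuantumFieldTheory.Balaban1983to89.T3ContinuumYM3Torus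
open Literature.MathematicalPhysics.QuantumFieldTheory.Balaban1983to89.T3UnitLawDensityEML (ℰp)
open Literature.MathematicalPhysics.QuantumFieldTheory.Balaban1983to89.T3ConstrainedMinimiser (fibre)
open Literature.MathematicalPhysics.QuantumFieldTheory.Balaban1983to89.T3PrintedRegularMinimiser (RegPr)
open Literature.MathematicalPhysics.QuantumFieldTheory.Balaban1983to89.T3SectALandauChart (In19 emb15 eta eta_pos bgUnits)
open B11Prop3Model (Dfix)
open B11Ineq190FromProp3 (hasFDerivAt_Dfix_of_lt)
open Summit.QuantumFields.YangMills.Theorems.Prop7TPrint (nMax19 expHermField expHerm coe_expHerm expHermField_apply)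
open Summit.QuantumFields.YangMills.Theorems.Prop7SPrint (NormS)
open Summit.QuantumFields.YangMills.Theorems.Prop7SymAvgTwSym (QTwS CmapTwS)
open Summit.QuantumFields.YangMills.Theorems.Prop7SymAvgGL (QSym)
open Summit.QuantumFields.YangMills.Theorems.Prop7CmapTwSymInputs (inputs_CmapTwS)
open Summit.QuantumFields.YangMills.Theorems.Prop7ChartRealityKnitS (isHermitian_trace_zero_of_chartS)
open Summit.QuantumFields.YangMills.Theorems.Prop7B8Prop7Div (regPr_emb15_of_in19)
open Summit.QuantumFields.YangMills.Theorems.Prop7PV3CDELogChart (in19_expHermField_of_nMax19_lt)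
open Summit.QuantumFields.YangMills.Theorems.Prop7ChartVelocityDexp (hasDerivAt_wilsonAction4_chartCurve)
open Summit.QuantumFields.YangMills.Theorems.Prop7TangentCriticalSplit (tangentCritical_su2_of_split)
open Summit.QuantumFields.YangMills.Theorems.Prop7FibreELOfTangentCriticalSU2 (fibreEL_of_tangentCritical_su2_QSym)

/-! ## §1 The clamped real line (generic) -/

section Clamp

variable {E : Type*} [NormedAddCommGroup E] [NormedSpace ℂ E]

/-- ★ **THE CLAMPED LINE**: for `t₀ > 0` the curve `t ↦ A′ + (max (−t₀) (min t t₀) : ℂ)•δ` agrees with the line `t ↦ A′ + t•δ` near `0`, so it has derivative `δ` at `0`; and its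
parameter never leaves `[−t₀, t₀]`. [folklore] -/
theorem hasDerivAt_clampLine (A' δ : E) {t₀ : ℝ} (ht₀ : 0 < t₀) :
    HasDerivAt (fun t : ℝ => A' + ((max (-t₀) (min t t₀) : ℝ) : ℂ) • δ) δ 0 := by
  have hline : HasDerivAt (fun t : ℝ => A' + ((t : ℝ) : ℂ) • δ) δ 0 := by
    have h1 : HasDerivAt (fun t : ℝ => ((t : ℝ) : ℂ) • δ) ((1 : ℂ) • δ) 0 := ((hasDerivAt_id (0 : ℝ)).ofReal_comp).smul_const δ
    rw [one_smul] at h1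
    exact h1.const_add A'
  refine hline.congr_of_eventuallyEq ?_
  filter_upwards [Ioo_mem_nhds (neg_lt_zero.2 ht₀) ht₀] with t ht
  rw [min_eq_left ht.2.le, max_eq_right ht.1.le]

omit [NormedSpace ℂ E] in
/-- the clamp stays in the segment: `|max (−t₀) (min t t₀)| ≤ t₀`. [folklore] -/
theorem abs_clamp_le {t₀ : ℝ} (ht₀ : 0 ≤ t₀) (t : ℝ) : |max (-t₀) (min t t₀)| ≤ t₀ :=
  abs_le.2 ⟨le_max_left _ _, max_le (by linarith) (min_le_right _ _)⟩

omit [NormedSpace ℂ E] in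
/-- the clamp is the identity near `0`. [folklore] -/
theorem clamp_eq_self {t₀ t : ℝ} (ht : t ∈ Set.Ioo (-t₀) t₀) : max (-t₀) (min t t₀) = t := by
  rw [min_eq_left ht.2.le, max_eq_right ht.1.le]

/-- a point of the clamped line lies in the ball `‖A″‖ ≤ ‖A′‖ + t₀‖δ‖`. [folklore] -/
theorem norm_clampLine_le (A' δ : E) {t₀ : ℝ} (ht₀ : 0 ≤ t₀) (t : ℝ) :
    ‖A' + ((max (-t₀) (min t t₀) : ℝ) : ℂ) • δ‖ ≤ ‖A'‖ + t₀ * ‖δ‖ := by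
  refine (norm_add_le _ _).trans (add_le_add le_rfl ?_)
  rw [norm_smul, Complex.norm_real, Real.norm_eq_abs]
  exact mul_le_mul_of_nonneg_right (abs_clamp_le ht₀ t) (norm_nonneg _)

/-- a real multiple of a skew-Hermitian-traceless field added to a skew-Hermitian-traceless field is skew-Hermitian-traceless. [folklore] -/
theorem skew_add_real_smul {ι : Type*} {A' δ : ι → Matrix (Fin 2) (Fin 2) ℂ}
    (hA' : ∀ b, star (A' b) = -A' b ∧ (A' b).trace = 0) (hδ : ∀ b, star (δ b) = -δ b ∧ (δ b).trace = 0) (s : ℝ) :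
    ∀ b, star ((A' + ((s : ℝ) : ℂ) • δ) b) = -(A' + ((s : ℝ) : ℂ) • δ) b ∧ ((A' + ((s : ℝ) : ℂ) • δ) b).trace = 0 := by
  intro b
  refine ⟨?_, ?_⟩
  · rw [Pi.add_apply, Pi.smul_apply, star_add, star_smul, Complex.star_def, Complex.conj_ofReal, (hA' b).1, (hδ b).1, smul_neg, neg_add]
  · rw [Pi.add_apply, Pi.smul_apply, Matrix.trace_add, Matrix.trace_smul, (hA' b).2, (hδ b).2, smul_zero, add_zero]

end Clamp

/-! ## §2 The member: (D47) and (51) along the ray -/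

section Member

variable (F : T3Family) {n K : ℕ} (h : n ≤ K) [Fact (0 < (F.L : ℝ))] [Fact (0 < ((F.L : ℝ)⁻¹) ^ (K - n))]

omit [Fact (0 < ((F.L : ℝ)⁻¹) ^ (K - n))] in
/-- ★★ **(D47) — THE (47)-MAP `χ(A″) = A″ − H·Dfix(CmapTwS U₀) H C₂ˢ A″` IS FRÉCHET-DIFFERENTIABLE IN THE HALF BALL**: at `U₀ ∈ 𝔘_k(ε₀)` (`10⁹L²e ≤ 1`, `10¹²L³ε₀ ≤ 1`), for a
`ℂ`-linear `H` with `‖HY‖ ≤ b‖Y‖`, in the contraction window `9C₂ˢbε < 1`, `6ε ≤ e·η`: every `A″` with `2‖A″‖ < ε` is a point of differentiability of `χ`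
(✓`hasFDerivAt_Dfix_of_lt` at `ε₃ := ε∕2`: `18C₂ˢb(ε∕2) = 9C₂ˢbε`, `2(ε∕2) ≤ (e·η)∕4`; the `Inputs` are ✓`inputs_CmapTwS`).
[cite: Balaban1985Variational, (47)–(49) p.285, (63)–(70) pp.287–289, Prop. 3 p.289] -/
theorem hasFDerivAt_chartTwS_of_lt {ε₀ e b ε : ℝ} (hε₀ : 0 < ε₀) (he : 0 < e) (hWe : 10 ^ 9 * (F.L : ℝ) ^ 2 * e ≤ 1) (hWε : 10 ^ 12 * (F.L : ℝ) ^ 3 * ε₀ ≤ 1)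
    (U₀ : GaugeField (F.P K) 0 (Matrix.specialUnitaryGroup (Fin 2) ℂ)) (hreg : RegPr F n K ε₀ U₀)
    {H : (PBond (F.P n) 0 → Matrix (Fin 2) (Fin 2) ℂ) →ₗ[ℂ] (PBond (F.P K) 0 → Matrix (Fin 2) (Fin 2) ℂ)} (hb : 0 ≤ b) (hHop : ∀ Y, ‖H Y‖ ≤ b * ‖Y‖)
    (hq : 9 * (40 * (2 * (3 * (2 * e + 2700 * (F.L : ℝ) * ε₀))) / (e * eta F n K) ^ 2) * b * ε < 1) (hRε : 6 * ε ≤ e * eta F n K)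
    {A'' : PBond (F.P K) 0 → Matrix (Fin 2) (Fin 2) ℂ} (hA'' : 2 * ‖A''‖ < ε) :
    HasFDerivAt (fun A : PBond (F.P K) 0 → Matrix (Fin 2) (Fin 2) ℂ => A - H (Dfix (CmapTwS F n K h U₀) H (40 * (2 * (3 * (2 * e + 2700 * (F.L : ℝ) * ε₀))) / (e * eta F n K) ^ 2) A))
      (fderiv ℂ (fun A : PBond (F.P K) 0 → Matrix (Fin 2) (Fin 2) ℂ =>
        A - H (Dfix (CmapTwS F n K h U₀) H (40 * (2 * (3 * (2 * e + 2700 * (F.L : ℝ) * ε₀))) / (e * eta F n K) ^ 2) A)) A'') A'' := by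
  haveI : CompleteSpace (PBond (F.P n) 0 → Matrix (Fin 2) (Fin 2) ℂ) := FiniteDimensional.complete ℂ _
  haveI : CompleteSpace (PBond (F.P K) 0 → Matrix (Fin 2) (Fin 2) ℂ) := FiniteDimensional.complete ℂ _
  set C₂ : ℝ := 40 * (2 * (3 * (2 * e + 2700 * (F.L : ℝ) * ε₀))) / (e * eta F n K) ^ 2 with hC₂def
  have hη : 0 < eta F n K := eta_pos F n K
  have hC₂ : 0 ≤ C₂ := by
    have hL : (0 : ℝ) < (F.L : ℝ) := Fact.out
    positivity
  -- `H` as a continuous linear map of the finite-dimensional carriers (same underlying linear map)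
  set Hc : (PBond (F.P n) 0 → Matrix (Fin 2) (Fin 2) ℂ) →L[ℂ] (PBond (F.P K) 0 → Matrix (Fin 2) (Fin 2) ℂ) := LinearMap.toContinuousLinearMap H with hHc
  have hHcH : (Hc : (PBond (F.P n) 0 → Matrix (Fin 2) (Fin 2) ℂ) →ₗ[ℂ] (PBond (F.P K) 0 → Matrix (Fin 2) (Fin 2) ℂ)) = H := LinearMap.coe_toContinuousLinearMap H
  have hin : B11Prop3Model.Inputs (CmapTwS F n K h U₀) (Hc : (PBond (F.P n) 0 → Matrix (Fin 2) (Fin 2) ℂ) →ₗ[ℂ] (PBond (F.P K) 0 → Matrix (Fin 2) (Fin 2) ℂ))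
      C₂ C₂ b ((e * eta F n K) / 4) := by
    rw [hHcH]; exact inputs_CmapTwS F h hε₀ he hWe hWε U₀ hreg hHop
  have hε₃ : 0 < ε / 2 := by linarith [norm_nonneg A'']
  have h18 : 18 * C₂ * b * (ε / 2) ≤ 1 := by
    have : 18 * C₂ * b * (ε / 2) = 9 * C₂ * b * ε := by ring
    rw [this]; exact hq.le
  have h2 : 2 * (ε / 2) ≤ (e * eta F n K) / 4 := by linarith
  have hA''3 : ‖A''‖ < ε / 2 := by linarith
  have hD := hasFDerivAt_Dfix_of_lt hin hC₂ hC₂ hb hε₃ h18 h2 hA''3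
  rw [hHcH] at hD
  -- `χ = id − H ∘ Dfix`
  have hχ : HasFDerivAt (fun A : PBond (F.P K) 0 → Matrix (Fin 2) (Fin 2) ℂ => A - H (Dfix (CmapTwS F n K h U₀) H C₂ A))
      ((ContinuousLinearMap.id ℂ _) - Hc.comp (fderiv ℂ (Dfix (CmapTwS F n K h U₀) H C₂) A'')) A'' := by
    have h1 : HasFDerivAt (fun A : PBond (F.P K) 0 → Matrix (Fin 2) (Fin 2) ℂ => Hc (Dfix (CmapTwS F n K h U₀) H C₂ A))
        (Hc.comp (fderiv ℂ (Dfix (CmapTwS F n K h U₀) H C₂) A'')) A'' := Hc.hasFDerivAt.comp A'' hD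
    have h2 := (hasFDerivAt_id (𝕜 := ℂ) A'').sub h1
    have hfun : (fun A : PBond (F.P K) 0 → Matrix (Fin 2) (Fin 2) ℂ => A - H (Dfix (CmapTwS F n K h U₀) H C₂ A))
        = fun A => id A - Hc (Dfix (CmapTwS F n K h U₀) H C₂ A) := by
      funext A; rw [id, LinearMap.coe_toContinuousLinearMap']
    rw [hfun]
    exact h2
  exact hχ.differentiableAt.hasFDerivAt

/-- ★★ **(51) ALONG THE RAY — `−i·χ(A″)` IS HERMITIAN-TRACELESS** for every skew-Hermitian-traceless `A″` with `‖A″‖ < ε` (so `expHermField(−i·χ(A″))(b) = e^{χ(A″)(b)}`, no junk branch):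
✓`isHermitian_trace_zero_of_chartS` read at `X := −i·χ(A″)` (the identity `χ(A″) = i·(−i·χ(A″))` is `i·(−i) = 1`). [cite: Balaban1985Variational, (51) p.286, (112) p.294] -/
theorem isHermitian_trace_zero_chartTwS {ε₀ e b ε : ℝ} (hε₀ : 0 < ε₀) (he : 0 < e) (hWe : 10 ^ 9 * (F.L : ℝ) ^ 2 * e ≤ 1) (hWε : 10 ^ 12 * (F.L : ℝ) ^ 3 * ε₀ ≤ 1)
    (U₀ : GaugeField (F.P K) 0 (Matrix.specialUnitaryGroup (Fin 2) ℂ)) (hreg : RegPr F n K ε₀ U₀)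
    {H : (PBond (F.P n) 0 → Matrix (Fin 2) (Fin 2) ℂ) →ₗ[ℂ] (PBond (F.P K) 0 → Matrix (Fin 2) (Fin 2) ℂ)} (hb : 0 ≤ b) (hHop : ∀ Y, ‖H Y‖ ≤ b * ‖Y‖)
    (hHR : ∀ Y : PBond (F.P n) 0 → Matrix (Fin 2) (Fin 2) ℂ, (∀ c, star (Y c) = -Y c ∧ (Y c).trace = 0) → ∀ b', star (H Y b') = -H Y b' ∧ (H Y b').trace = 0)
    (hq : 9 * (40 * (2 * (3 * (2 * e + 2700 * (F.L : ℝ) * ε₀))) / (e * eta F n K) ^ 2) * b * ε < 1) (hRε : 6 * ε ≤ e * eta F n K)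
    {A'' : PBond (F.P K) 0 → Matrix (Fin 2) (Fin 2) ℂ} (hA''ε : ‖A''‖ < ε) (hA''R : ∀ b', star (A'' b') = -A'' b' ∧ (A'' b').trace = 0) :
    ∀ b' : PBond (F.P K) 0,
      ((-Complex.I) • (A'' - H (Dfix (CmapTwS F n K h U₀) H (40 * (2 * (3 * (2 * e + 2700 * (F.L : ℝ) * ε₀))) / (e * eta F n K) ^ 2) A'')) b').IsHermitian ∧
      ((-Complex.I) • (A'' - H (Dfix (CmapTwS F n K h U₀) H (40 * (2 * (3 * (2 * e + 2700 * (F.L : ℝ) * ε₀))) / (e * eta F n K) ^ 2) A'')) b').trace = 0 := by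
  refine isHermitian_trace_zero_of_chartS F h hε₀ he hWe hWε U₀ hreg hb hHop hHR hq hRε hA''ε hA''R
    (X := fun b' => (-Complex.I) • (A'' - H (Dfix (CmapTwS F n K h U₀) H (40 * (2 * (3 * (2 * e + 2700 * (F.L : ℝ) * ε₀))) / (e * eta F n K) ^ 2) A'')) b') ?_
  funext b'
  simp only [smul_smul, mul_neg, Complex.I_mul_I, neg_neg, one_smul]

omit [Fact (0 < (F.L : ℝ))] [Fact (0 < ((F.L : ℝ)⁻¹) ^ (K - n))] in
/-- the bond values of the chart configuration: for Hermitian-traceless `X`, `emb15 U₀ (expHermField X) b = e^{iX(b)}·U₀(b)`. [cite: Balaban1985Variational, (15) p.280, (112) p.294] -/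
theorem coe_emb15_expHermField (U₀ : GaugeField (F.P K) 0 (Matrix.specialUnitaryGroup (Fin 2) ℂ)) {X : PBond (F.P K) 0 → Matrix (Fin 2) (Fin 2) ℂ}
    (hX : ∀ b, (X b).IsHermitian ∧ (X b).trace = 0) (b : PBond (F.P K) 0) :
    ((emb15 U₀ (expHermField X) b : Matrix.specialUnitaryGroup (Fin 2) ℂ) : Matrix (Fin 2) (Fin 2) ℂ)
      = exp (Complex.I • X b) * ((U₀ b : Matrix.specialUnitaryGroup (Fin 2) ℂ) : Matrix (Fin 2) (Fin 2) ℂ) := by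
  rw [show emb15 U₀ (expHermField X) b = expHermField X b * U₀ b from rfl, Submonoid.coe_mul, expHermField_apply, coe_expHerm (hX b)]

/-! ## §3 (93) in ray form ⟹ `Lin_{U′}` vanishes on the `U′`-velocity of the slice ray -/

/-- ★★★ **`hCrit` (THE RAY FORM OF (93) AT `A′` IN THE DIRECTION `δ`) ⟹ `Lin_{U′}(g(ad(−iX))(Dχ(A′)δ)) = 0`.**  Data: `U₀ ∈ 𝔘_k(ε₀)` with (WF), the (46) letter `H` (bound `b`,
REAL), the contraction window `9C₂ˢbε < 1`, `6ε ≤ eη`; a skew-Hermitian-traceless `A′` in the HALF ball `2‖A′‖ < ε` with `χ(A′) = iX`, `X` Hermitian-traceless; a skew-Hermitian-traceless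
direction `δ` along which the chart functional `t ↦ 𝒜(emb15 U₀ (expHermField(−i·χ(A′ + tδ))))` has `deriv … 0 = 0`.  Then the first variation `Lin_{U′}` at `U′ = emb15 U₀ (expHermField X)`
vanishes on the bond field `b ↦ g(ad(−iX(b)))((Dχ(A′)δ)(b))` — the right-trivialised `U′`-velocity of the ray (T1 ✓`hasDerivAt_wilsonAction4_chartCurve` along the CLAMPED ray, which is
`SU(2)`-valued for all `t` by (51) and agrees with the displayed ray near `0`). [cite: Balaban1985Variational, (93) p.291, (82)-(83) p.290, (47)-(51) pp.285-286, (26)-(27) p.282; Balaban1985Averaging, (32)-(34) pp.22-23] -/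
theorem lin_eq_zero_of_crit_ray {ε₀ e b ε : ℝ} (hε₀ : 0 < ε₀) (he : 0 < e) (hWe : 10 ^ 9 * (F.L : ℝ) ^ 2 * e ≤ 1) (hWε : 10 ^ 12 * (F.L : ℝ) ^ 3 * ε₀ ≤ 1)
    (U₀ : GaugeField (F.P K) 0 (Matrix.specialUnitaryGroup (Fin 2) ℂ)) (hreg : RegPr F n K ε₀ U₀)
    {H : (PBond (F.P n) 0 → Matrix (Fin 2) (Fin 2) ℂ) →ₗ[ℂ] (PBond (F.P K) 0 → Matrix (Fin 2) (Fin 2) ℂ)} (hb : 0 ≤ b) (hHop : ∀ Y, ‖H Y‖ ≤ b * ‖Y‖)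
    (hHR : ∀ Y : PBond (F.P n) 0 → Matrix (Fin 2) (Fin 2) ℂ, (∀ c, star (Y c) = -Y c ∧ (Y c).trace = 0) → ∀ b', star (H Y b') = -H Y b' ∧ (H Y b').trace = 0)
    (hq : 9 * (40 * (2 * (3 * (2 * e + 2700 * (F.L : ℝ) * ε₀))) / (e * eta F n K) ^ 2) * b * ε < 1) (hRε : 6 * ε ≤ e * eta F n K)
    {A' : PBond (F.P K) 0 → Matrix (Fin 2) (Fin 2) ℂ} (hA'ε : 2 * ‖A'‖ < ε) (hA'R : ∀ b', star (A' b') = -A' b' ∧ (A' b').trace = 0)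
    {X : PBond (F.P K) 0 → Matrix (Fin 2) (Fin 2) ℂ} (hX : ∀ b, (X b).IsHermitian ∧ (X b).trace = 0)
    (hAX : A' - H (Dfix (CmapTwS F n K h U₀) H (40 * (2 * (3 * (2 * e + 2700 * (F.L : ℝ) * ε₀))) / (e * eta F n K) ^ 2) A') = fun b' => Complex.I • X b')
    {δ : PBond (F.P K) 0 → Matrix (Fin 2) (Fin 2) ℂ} (hδR : ∀ b', star (δ b') = -δ b' ∧ (δ b').trace = 0)
    (hcrit : deriv (fun t : ℝ => wilsonAction4 (emb15 U₀ (expHermField (fun b' : PBond (F.P K) 0 => (-Complex.I) •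
        ((A' + (t : ℂ) • δ) - H (Dfix (CmapTwS F n K h U₀) H (40 * (2 * (3 * (2 * e + 2700 * (F.L : ℝ) * ε₀))) / (e * eta F n K) ^ 2) (A' + (t : ℂ) • δ))) b')))) 0 = 0) :
    ∑ p : Plaq (F.P K) 0, (1 / 2) * ((((((GaugeField.plaqHol (emb15 U₀ (expHermField X)) p : Matrix.specialUnitaryGroup (Fin 2) ℂ) : Matrix (Fin 2) (Fin 2) ℂ)) - 1)ᴴ
        * (((fun b' : PBond (F.P K) 0 => gSer ℂ (ad ℂ (-(fun b'' : PBond (F.P K) 0 => Complex.I • X b'') b'))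
              ((fderiv ℂ (fun A : PBond (F.P K) 0 → Matrix (Fin 2) (Fin 2) ℂ =>
                A - H (Dfix (CmapTwS F n K h U₀) H (40 * (2 * (3 * (2 * e + 2700 * (F.L : ℝ) * ε₀))) / (e * eta F n K) ^ 2) A)) A' δ) b')) ⟨p.src, p.μ⟩
            + (emb15 U₀ (expHermField X) ⟨p.src, p.μ⟩ : Matrix (Fin 2) (Fin 2) ℂ)
                * (fun b' : PBond (F.P K) 0 => gSer ℂ (ad ℂ (-(fun b'' : PBond (F.P K) 0 => Complex.I • X b'') b'))
                    ((fderiv ℂ (fun A : PBond (F.P K) 0 → Matrix (Fin 2) (Fin 2) ℂ =>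
                      A - H (Dfix (CmapTwS F n K h U₀) H (40 * (2 * (3 * (2 * e + 2700 * (F.L : ℝ) * ε₀))) / (e * eta F n K) ^ 2) A)) A' δ) b')) ⟨p.src.shift p.μ, p.ν⟩
                * star (emb15 U₀ (expHermField X) ⟨p.src, p.μ⟩ : Matrix (Fin 2) (Fin 2) ℂ)
            - ((emb15 U₀ (expHermField X) ⟨p.src, p.μ⟩ * emb15 U₀ (expHermField X) ⟨p.src.shift p.μ, p.ν⟩ * (emb15 U₀ (expHermField X) ⟨p.src.shift p.ν, p.μ⟩)⁻¹ :
                  Matrix.specialUnitaryGroup (Fin 2) ℂ) : Matrix (Fin 2) (Fin 2) ℂ)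
                * (fun b' : PBond (F.P K) 0 => gSer ℂ (ad ℂ (-(fun b'' : PBond (F.P K) 0 => Complex.I • X b'') b'))
                    ((fderiv ℂ (fun A : PBond (F.P K) 0 → Matrix (Fin 2) (Fin 2) ℂ =>
                      A - H (Dfix (CmapTwS F n K h U₀) H (40 * (2 * (3 * (2 * e + 2700 * (F.L : ℝ) * ε₀))) / (e * eta F n K) ^ 2) A)) A' δ) b')) ⟨p.src.shift p.ν, p.μ⟩
                * star ((emb15 U₀ (expHermField X) ⟨p.src, p.μ⟩ * emb15 U₀ (expHermField X) ⟨p.src.shift p.μ, p.ν⟩ * (emb15 U₀ (expHermField X) ⟨p.src.shift p.ν, p.μ⟩)⁻¹ :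
                  Matrix.specialUnitaryGroup (Fin 2) ℂ) : Matrix (Fin 2) (Fin 2) ℂ)
            - ((GaugeField.plaqHol (emb15 U₀ (expHermField X)) p : Matrix.specialUnitaryGroup (Fin 2) ℂ) : Matrix (Fin 2) (Fin 2) ℂ)
                * (fun b' : PBond (F.P K) 0 => gSer ℂ (ad ℂ (-(fun b'' : PBond (F.P K) 0 => Complex.I • X b'') b'))
                    ((fderiv ℂ (fun A : PBond (F.P K) 0 → Matrix (Fin 2) (Fin 2) ℂ =>
                      A - H (Dfix (CmapTwS F n K h U₀) H (40 * (2 * (3 * (2 * e + 2700 * (F.L : ℝ) * ε₀))) / (e * eta F n K) ^ 2) A)) A' δ) b')) ⟨p.src, p.ν⟩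
                * star ((GaugeField.plaqHol (emb15 U₀ (expHermField X)) p : Matrix.specialUnitaryGroup (Fin 2) ℂ) : Matrix (Fin 2) (Fin 2) ℂ))
          * ((GaugeField.plaqHol (emb15 U₀ (expHermField X)) p : Matrix.specialUnitaryGroup (Fin 2) ℂ) : Matrix (Fin 2) (Fin 2) ℂ))).trace).re = 0 := by
  -- abbreviations
  set C₂ : ℝ := 40 * (2 * (3 * (2 * e + 2700 * (F.L : ℝ) * ε₀))) / (e * eta F n K) ^ 2 with hC₂def
  set χ : (PBond (F.P K) 0 → Matrix (Fin 2) (Fin 2) ℂ) → (PBond (F.P K) 0 → Matrix (Fin 2) (Fin 2) ℂ) :=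
    fun A => A - H (Dfix (CmapTwS F n K h U₀) H C₂ A) with hχdef
  set A₁ : PBond (F.P K) 0 → Matrix (Fin 2) (Fin 2) ℂ := fun b'' => Complex.I • X b'' with hA₁def
  set U' : GaugeField (F.P K) 0 (Matrix.specialUnitaryGroup (Fin 2) ℂ) := emb15 U₀ (expHermField X) with hU'def
  set α : PBond (F.P K) 0 → Matrix (Fin 2) (Fin 2) ℂ := fderiv ℂ χ A' δ with hαdef
  have hε : 0 < ε := by linarith [norm_nonneg A']
  -- the clamp parameter `t₀`: `‖A′‖ + t₀‖δ‖ < ε∕2`... precisely `≤ ‖A′‖ + (ε∕2 − ‖A′‖)·‖δ‖∕(‖δ‖+1) < ε`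
  set t₀ : ℝ := (ε / 2 - ‖A'‖) / (‖δ‖ + 1) with ht₀def
  have hgap : 0 < ε / 2 - ‖A'‖ := by linarith
  have hδ1 : 0 < ‖δ‖ + 1 := by linarith [norm_nonneg δ]
  have ht₀ : 0 < t₀ := div_pos hgap hδ1
  have ht₀δ : t₀ * ‖δ‖ ≤ ε / 2 - ‖A'‖ := by
    rw [ht₀def, div_mul_eq_mul_div, div_le_iff₀ hδ1]
    nlinarith [norm_nonneg δ, hgap.le]
  -- the clamped ray in `U₀`'s chart coordinates and its chart image
  set r : ℝ → (PBond (F.P K) 0 → Matrix (Fin 2) (Fin 2) ℂ) := fun t => A' + ((max (-t₀) (min t t₀) : ℝ) : ℂ) • δ with hrdef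
  have hrε : ∀ t, ‖r t‖ < ε := fun t => by
    have h1 := norm_clampLine_le A' δ ht₀.le t
    have : ‖A'‖ + t₀ * ‖δ‖ < ε := by linarith
    exact lt_of_le_of_lt h1 this
  have hrR : ∀ t b', star (r t b') = -r t b' ∧ (r t b').trace = 0 := fun t => skew_add_real_smul hA'R hδR _
  -- (51) along the ray: `−i·χ(r t)` is Hermitian-traceless, so the configuration curve is honestly `e^{χ(r t)}U₀`
  have hXt : ∀ t b', ((-Complex.I) • (χ (r t)) b').IsHermitian ∧ ((-Complex.I) • (χ (r t)) b').trace = 0 := fun t =>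
    isHermitian_trace_zero_chartTwS F h hε₀ he hWe hWε U₀ hreg hb hHop hHR hq hRε (hrε t) (hrR t)
  set Γ : ℝ → GaugeField (F.P K) 0 (Matrix.specialUnitaryGroup (Fin 2) ℂ) := fun t => emb15 U₀ (expHermField (fun b' => (-Complex.I) • (χ (r t)) b')) with hΓdef
  have hΓ : ∀ t b', ((Γ t b' : Matrix.specialUnitaryGroup (Fin 2) ℂ) : Matrix (Fin 2) (Fin 2) ℂ)
      = exp ((fun t => χ (r t)) t b') * ((U₀ b' : Matrix.specialUnitaryGroup (Fin 2) ℂ) : Matrix (Fin 2) (Fin 2) ℂ) := by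
    intro t b'
    rw [hΓdef, coe_emb15_expHermField F U₀ (hXt t) b', smul_smul, mul_neg, Complex.I_mul_I, neg_neg, one_smul]
  -- `U′ = e^{A₁}U₀`, `A₁ = iX` skew-Hermitian, `χ(A′) = A₁`
  have hU' : ∀ b', ((U' b' : Matrix.specialUnitaryGroup (Fin 2) ℂ) : Matrix (Fin 2) (Fin 2) ℂ) = exp (A₁ b') * ((U₀ b' : Matrix.specialUnitaryGroup (Fin 2) ℂ) : Matrix (Fin 2) (Fin 2) ℂ) :=
    fun b' => coe_emb15_expHermField F U₀ hX b'
  have hA₁ : ∀ b', star (A₁ b') = -A₁ b' := fun b' => by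
    rw [hA₁def]
    show star (Complex.I • X b') = -(Complex.I • X b')
    rw [star_smul, Complex.star_def, Complex.conj_I, Matrix.star_eq_conjTranspose, (hX b').1.eq, neg_smul]
  have hχA' : χ A' = A₁ := hAX
  -- the chart image of the clamped ray: `c 0 = A₁`, velocity `α` at `0`
  have hc0 : (fun t => χ (r t)) 0 = A₁ := by
    show χ (r 0) = A₁
    have : r 0 = A' := by
      rw [hrdef]
      show A' + ((max (-t₀) (min 0 t₀) : ℝ) : ℂ) • δ = A'
      rw [min_eq_left ht₀.le, max_eq_right (neg_nonpos.2 ht₀.le), Complex.ofReal_zero, zero_smul, add_zero]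
    rw [this, hχA']
  have hχ' : HasFDerivAt χ (fderiv ℂ χ A') A' := hasFDerivAt_chartTwS_of_lt F h hε₀ he hWe hWε U₀ hreg hb hHop hq hRε hA'ε
  have hcurve : HasDerivAt (fun t => χ (r t)) α 0 := by
    have hr : HasDerivAt r δ 0 := hasDerivAt_clampLine A' δ ht₀
    have hr0 : r 0 = A' := by
      rw [hrdef]
      show A' + ((max (-t₀) (min 0 t₀) : ℝ) : ℂ) • δ = A'
      rw [min_eq_left ht₀.le, max_eq_right (neg_nonpos.2 ht₀.le), Complex.ofReal_zero, zero_smul, add_zero]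
    have h1 : HasFDerivAt χ ((fderiv ℂ χ A').restrictScalars ℝ) (r 0) := by rw [hr0]; exact hχ'.restrictScalars ℝ
    have h2 := h1.comp_hasDerivAt (0 : ℝ) hr
    exact h2
  have hcd : ∀ b', HasDerivAt (fun t => (fun t => χ (r t)) t b') (α b') 0 := fun b' => (hasDerivAt_pi.1 hcurve) b'
  -- T1: the first variation along the clamped chart curve through `U′`
  have hT1 := hasDerivAt_wilsonAction4_chartCurve F U₀ U' A₁ hA₁ hU' (fun t => χ (r t)) α hc0 hcd Γ hΓ
  -- the clamped curve agrees with the displayed ray near `t = 0`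
  have hEq : (fun t : ℝ => wilsonAction4 (emb15 U₀ (expHermField (fun b' : PBond (F.P K) 0 => (-Complex.I) • (χ (A' + (t : ℂ) • δ)) b'))))
      =ᶠ[𝓝 (0 : ℝ)] (fun t => wilsonAction4 (Γ t)) := by
    filter_upwards [Ioo_mem_nhds (neg_lt_zero.2 ht₀) ht₀] with t ht
    rw [hΓdef]
    show wilsonAction4 (emb15 U₀ (expHermField (fun b' : PBond (F.P K) 0 => (-Complex.I) • (χ (A' + (t : ℂ) • δ)) b')))
      = wilsonAction4 (emb15 U₀ (expHermField (fun b' => (-Complex.I) • (χ (r t)) b')))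
    rw [hrdef]
    show _ = wilsonAction4 (emb15 U₀ (expHermField (fun b' => (-Complex.I) • (χ (A' + ((max (-t₀) (min t t₀) : ℝ) : ℂ) • δ)) b')))
    rw [clamp_eq_self ht]
  have hray : HasDerivAt (fun t : ℝ => wilsonAction4 (emb15 U₀ (expHermField (fun b' : PBond (F.P K) 0 => (-Complex.I) • (χ (A' + (t : ℂ) • δ)) b')))) _ 0 :=
    hT1.congr_of_eventuallyEq hEq
  have hd := hray.deriv
  rw [hcrit] at hd
  exact hd.symm

/-! ## §4 Conjunct (iii) of `hXtw‴` from (93) and the slice split -/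

/-- ★★★ **CONJUNCT (iii) OF THE KNIT'S XL ROW `hXtw‴`, PROVED FROM PRINT'S (93) (RAY FORM, `hCrit`) AND THE INFINITESIMAL SLICE THEOREM AT THE CHART POINT (`hSplit`).**
Member `(F, n ≤ K)`; background `U₀ ∈ 𝔘_k(ε₀)` with (WF) `10⁹L²e ≤ 1`, `10¹²L³ε₀ ≤ 1` and the regularity window `10⁷L³·178(ε₀ + e) ≤ 1`; the (46) letter `H` (bound `b ≥ 0`, REAL); the contraction
window `9C₂ˢbε < 1`, `6ε ≤ eη`; the chart coordinate `A′` (skew-Hermitian-traceless, HALF ball `2‖A′‖ < ε`) with `χ(A′) = iX`, `X` Hermitian-traceless of (19)-size `< e`; a slice predicate `Sl`.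
HYPOTHESES OF CONTENT: `hCrit` — for every skew-Hermitian-traceless `δ` with `Sl δ`, the chart functional `t ↦ 𝒜(emb15 U₀ (expHermField(−i·χ(A′ + tδ))))` has zero derivative at `0`
([Balaban1985Variational] (93) at the solution of (111)); `hSplit` — every `𝔰𝔲(2)`-valued `ξ` with `QSym(U′)ξ = 0` is `g(ad(−χ(A′)))(Dχ(A′)δ) + (iN(b₋) − U′(b)·iN(b₊)·U′(b)^*)` with `δ` real,
`Sl δ`, `N` Hermitian-traceless ([Balaban1985RegularSpaces] Sect. D linearised at `U′`).  CONCLUSION: conjunct (iii) VERBATIM — for every `u` (`NormS`-normalised) with `(U′)^u ∈ 𝔅_k(V)`, every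
curve `γ` through `(U′)^u` inside `𝔅_k(V)`, bondwise differentiable at `0`, has `deriv (𝒜 ∘ γ) 0 = 0`.  Proof: `U′ ∈ 𝔘_k(178(ε₀+e))` ([Balaban1985RegularSpaces] Prop. 7), `hcrit` by
✓`tangentCritical_su2_of_split` on `T := {g(ad(−iX))(Dχ(A′)δ) | δ real, Sl δ}` (§3 gives `hT`), then ✓`fibreEL_of_tangentCritical_su2_QSym`.
[cite: Balaban1985Variational, (93) p.291, (82)-(83) p.290, (141) p.299, Prop. 5 p.294, (112) p.294, (47)-(51) pp.285-286; Balaban1985RegularSpaces, Prop. 7 p.98, Sect. D pp.89-95; Balaban1985Averaging, Prop. 4 p.31, (32)-(34) pp.22-23] -/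
theorem fibreEL_of_crit_split {ε₀ e b ε : ℝ} (hε₀ : 0 < ε₀) (he : 0 < e) (hWe : 10 ^ 9 * (F.L : ℝ) ^ 2 * e ≤ 1) (hWε : 10 ^ 12 * (F.L : ℝ) ^ 3 * ε₀ ≤ 1)
    (hw137 : 10 ^ 7 * (F.L : ℝ) ^ 3 * (178 * (ε₀ + e)) ≤ 1)
    (U₀ : GaugeField (F.P K) 0 (Matrix.specialUnitaryGroup (Fin 2) ℂ)) (hreg : RegPr F n K ε₀ U₀)
    {H : (PBond (F.P n) 0 → Matrix (Fin 2) (Fin 2) ℂ) →ₗ[ℂ] (PBond (F.P K) 0 → Matrix (Fin 2) (Fin 2) ℂ)} (hb : 0 ≤ b) (hHop : ∀ Y, ‖H Y‖ ≤ b * ‖Y‖)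
    (hHR : ∀ Y : PBond (F.P n) 0 → Matrix (Fin 2) (Fin 2) ℂ, (∀ c, star (Y c) = -Y c ∧ (Y c).trace = 0) → ∀ b', star (H Y b') = -H Y b' ∧ (H Y b').trace = 0)
    (hq : 9 * (40 * (2 * (3 * (2 * e + 2700 * (F.L : ℝ) * ε₀))) / (e * eta F n K) ^ 2) * b * ε < 1) (hRε : 6 * ε ≤ e * eta F n K)
    {A' : PBond (F.P K) 0 → Matrix (Fin 2) (Fin 2) ℂ} (hA'ε : 2 * ‖A'‖ < ε) (hA'R : ∀ b', star (A' b') = -A' b' ∧ (A' b').trace = 0)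
    {X : PBond (F.P K) 0 → Matrix (Fin 2) (Fin 2) ℂ} (hX : ∀ b, (X b).IsHermitian ∧ (X b).trace = 0)
    (hAX : A' - H (Dfix (CmapTwS F n K h U₀) H (40 * (2 * (3 * (2 * e + 2700 * (F.L : ℝ) * ε₀))) / (e * eta F n K) ^ 2) A') = fun b' => Complex.I • X b')
    (hsize : nMax19 F n K U₀ X < e)
    (Sl : (PBond (F.P K) 0 → Matrix (Fin 2) (Fin 2) ℂ) → Prop)
    (hCrit : ∀ δ : PBond (F.P K) 0 → Matrix (Fin 2) (Fin 2) ℂ, (∀ b', star (δ b') = -δ b' ∧ (δ b').trace = 0) → Sl δ →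
      deriv (fun t : ℝ => wilsonAction4 (emb15 U₀ (expHermField (fun b' : PBond (F.P K) 0 => (-Complex.I) •
        ((A' + (t : ℂ) • δ) - H (Dfix (CmapTwS F n K h U₀) H (40 * (2 * (3 * (2 * e + 2700 * (F.L : ℝ) * ε₀))) / (e * eta F n K) ^ 2) (A' + (t : ℂ) • δ))) b')))) 0 = 0)
    (hSplit : ∀ ξ : PBond (F.P K) 0 → Matrix (Fin 2) (Fin 2) ℂ, (∀ b', star (ξ b') = -ξ b' ∧ (ξ b').trace = 0) →
      QSym F n K h (emb15 U₀ (expHermField X)) ξ = 0 →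
      ∃ δ : PBond (F.P K) 0 → Matrix (Fin 2) (Fin 2) ℂ, (∀ b', star (δ b') = -δ b' ∧ (δ b').trace = 0) ∧ Sl δ ∧
        ∃ N : Site (F.P K) 0 → Matrix (Fin 2) (Fin 2) ℂ, (∀ x, (N x).IsHermitian ∧ (N x).trace = 0) ∧
          ∀ b' : PBond (F.P K) 0, ξ b' =
            gSer ℂ (ad ℂ (-(A' - H (Dfix (CmapTwS F n K h U₀) H (40 * (2 * (3 * (2 * e + 2700 * (F.L : ℝ) * ε₀))) / (e * eta F n K) ^ 2) A')) b'))
              ((fderiv ℂ (fun A : PBond (F.P K) 0 → Matrix (Fin 2) (Fin 2) ℂ =>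
                A - H (Dfix (CmapTwS F n K h U₀) H (40 * (2 * (3 * (2 * e + 2700 * (F.L : ℝ) * ε₀))) / (e * eta F n K) ^ 2) A)) A' δ) b')
            + (Complex.I • N b'.src - ((emb15 U₀ (expHermField X) b' : Matrix.specialUnitaryGroup (Fin 2) ℂ) : Matrix (Fin 2) (Fin 2) ℂ) * (Complex.I • N b'.tgt)
                * star ((emb15 U₀ (expHermField X) b' : Matrix.specialUnitaryGroup (Fin 2) ℂ) : Matrix (Fin 2) (Fin 2) ℂ)))
    (V : GaugeField (F.P n) 0 (Matrix.specialUnitaryGroup (Fin 2) ℂ)) :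
    ∀ u : GaugeTransf (F.P K) 0 (Matrix.specialUnitaryGroup (Fin 2) ℂ), NormS F n K h U₀ X (expHermField X) u →
      GaugeField.gaugeAct u (emb15 U₀ (expHermField X)) ∈ fibre F ℰp n K h V →
      ∀ γ : ℝ → GaugeField (F.P K) 0 (Matrix.specialUnitaryGroup (Fin 2) ℂ), γ 0 = GaugeField.gaugeAct u (emb15 U₀ (expHermField X)) →
        (∀ t, γ t ∈ fibre F ℰp n K h V) →
        (∀ b, DifferentiableAt ℝ (fun t => ((γ t b : Matrix.specialUnitaryGroup (Fin 2) ℂ) : Matrix (Fin 2) (Fin 2) ℂ)) 0) →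
          deriv (fun t => wilsonAction4 (γ t)) 0 = 0 := by
  intro u _ _ γ hγ0 hγfib hγdiff
  set C₂ : ℝ := 40 * (2 * (3 * (2 * e + 2700 * (F.L : ℝ) * ε₀))) / (e * eta F n K) ^ 2 with hC₂def
  set χ : (PBond (F.P K) 0 → Matrix (Fin 2) (Fin 2) ℂ) → (PBond (F.P K) 0 → Matrix (Fin 2) (Fin 2) ℂ) :=
    fun A => A - H (Dfix (CmapTwS F n K h U₀) H C₂ A) with hχdef
  set A₁ : PBond (F.P K) 0 → Matrix (Fin 2) (Fin 2) ℂ := fun b'' => Complex.I • X b'' with hA₁def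
  set U' : GaugeField (F.P K) 0 (Matrix.specialUnitaryGroup (Fin 2) ℂ) := emb15 U₀ (expHermField X) with hU'def
  -- the chart point is printed-regular of radius `178(ε₀ + e)` ([Balaban1985RegularSpaces] Prop. 7 through (19))
  have hL1 : (1 : ℝ) ≤ (F.L : ℝ) := by
    have hL : (0 : ℝ) < (F.L : ℝ) := Fact.out
    have hL' : 0 < F.L := by exact_mod_cast hL
    exact_mod_cast hL'
  have hL3 : (1 : ℝ) ≤ (F.L : ℝ) ^ 3 := one_le_pow₀ hL1
  have hε₂ : ε₀ + e ≤ 1 / 4 := by nlinarith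
  have h19 : In19 F n K (ε₀ + e) U₀ (expHermField X) X := in19_expHermField_of_nMax19_lt hX (hsize.trans_le (by linarith))
  have hreg' : RegPr F n K (178 * (ε₀ + e)) U' := regPr_emb15_of_in19 F n K hε₂ (by linarith) hreg h19
  have hpos' : 0 < 178 * (ε₀ + e) := by positivity
  have hχA' : χ A' = A₁ := hAX
  -- `hcrit` at `U′` from `hT` on the slice velocities and the split
  refine fibreEL_of_tangentCritical_su2_QSym F h hpos' hw137 hreg'
    (tangentCritical_su2_of_split U' (fun ξ => QSym F n K h U' ξ = 0)
      {τ | ∃ δ : PBond (F.P K) 0 → Matrix (Fin 2) (Fin 2) ℂ, (∀ b', star (δ b') = -δ b' ∧ (δ b').trace = 0) ∧ Sl δ ∧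
        τ = fun b' => gSer ℂ (ad ℂ (-A₁ b')) ((fderiv ℂ χ A' δ) b')} ?_ ?_) u rfl γ hγ0 hγfib hγdiff
  · -- `hT`: `Lin_{U′}` vanishes on the velocities of the slice rays (§3)
    rintro τ ⟨δ, hδR, hδS, rfl⟩
    exact lin_eq_zero_of_crit_ray F h hε₀ he hWe hWε U₀ hreg hb hHop hHR hq hRε hA'ε hA'R hX hAX hδR (hCrit δ hδR hδS)
  · -- `hsplit`: the displayed split, re-packaged as membership in `T`
    intro ξ hξ hK
    obtain ⟨δ, hδR, hδS, N, hN, hξeq⟩ := hSplit ξ hξ hK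
    have hAX' : A' - H (Dfix (CmapTwS F n K h U₀) H C₂ A') = A₁ := hAX
    refine ⟨_, ⟨δ, hδR, hδS, rfl⟩, N, hN, fun b' => ?_⟩
    rw [hξeq b', hAX']

end Member

end Summit.QuantumFields.YangMills.Theorems.Prop7FibreELOfCritSplit

end
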